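import Summits.AnomalousDissipation.AnomalousDissipation.Theorems.QuasiStaticSolenoidalCellTensorQ.Negative.GalerkinFloor
import Summits.AnomalousDissipation.AnomalousDissipation.Theorems.QuasiStaticSolenoidalCellTensorQ.Negative.FloorParams
import Summits.AnomalousDissipation.AnomalousDissipation.Theorems.QuasiStaticSolenoidalCellTensorQ.Negative.FloorParams2
import Summits.AnomalousDissipation.AnomalousDissipation.Theorems.QuasiStaticSolenoidalCellTensorQ.Negative.FloorParams3
import Summits.AnomalousDissipation.AnomalousDissipation.Theorems.SolenoidalFractalHomogenisationRealisedQuasiStaticCellLawUpperSomeDatum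
import Summits.AnomalousDissipation.AnomalousDissipation.Theorems.SolenoidalFractalHomogenisationRealisedQuasiStaticCellLawWeakFarSlotAlgebra
import HarnessLib

/-!
# Negative side of K2Q `QuasiStaticSolenoidalCellTensorQ` (stmt-AnomalousDissipation-19072) and the vacuity of K1
# `ProjectedRenormalisationStep` (stmt-AnomalousDissipation-19071): the general-word REALISED energy floor, assembled

Summits-side helper file (everything proved; no definitions, no named facts).  `floorAll` is, literally, the hypothesis
`hfloor` of `…Negative.not_quasiStatic_of_floorAll` (Reduction, p802504): for EVERY isotropic lattice word `W`
(`IsotropicWordGain W c₀`, `c₀ > 0`), every precision `δ > 0` and every cell viscosity `ν > 0` there are a cell number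
`n₀` and the transient constant `C = 1/4` such that for all `n ≥ n₀` and every horizon `T > 0` SOME weak `A = 0`
passive-vector solution around the replayed `1/n`-cells `(W.stretch (1/ν)).cell n` from the gravest single mode
`Re(e_{e₀}) e₁` keeps, for a.e. `t ∈ (0,T)`, at least `C·exp(−8π²(1 + (1+δ)(1−4ρ/3)c₀/ν²)(ν/n²)t)·‖w₀‖²` — the floor at
the REALISED Taylor constant `(1−4ρ/3)c₀` of the ramped word (F12), for an ARBITRARY word (no long-slot hypothesis).
Assembly only: `galerkin_floor_cell` (p802453) at `W' = W.stretch (1/ν)`, `κ = ν/n²`, `ℓ = e₀`, windows of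
`q = ⌈32/(π²(1−4ρ/3)τ_min δ′)⌉ + ⌈1/P⌉ + 1` periods, `ε = δ′/8`, cone `η = 4Δ₁/(π²q(1−4ρ/3)τ_min)` (`δ′ = min δ 1`); numeric
hypotheses / rate budget = `gap_param`, `cone_params`, `drain_const_le`, `rate_budget` (FloorParams 1–3); datum facts from
UpperSomeDatum; weak solution by `exists_weak_singleMode_of_galerkinLowerBound`.  Consequences (separate files): `¬ K2Q`, and
the K1 item `ProjectedRenormalisationStep` holds VACUOUSLY.  This is NOT a proof of anomalous dissipation.
-/

set_option linter.dupNamespace false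

noncomputable section

namespace Summit.AnomalousDissipation.AnomalousDissipation.Theorems.QuasiStaticSolenoidalCellTensorQ.Negative

open Set MeasureTheory Filter Topology Function
open scoped InnerProductSpace
open Literature.Analysis Literature.Analysis.FunctionSpaces Literature.Analysis.FunctionSpaces.Torus
open Literature.Analysis.FluidPDE Literature.Analysis.FluidPDE.LatticeShear
open Summit.AnomalousDissipation.AnomalousDissipation.Theorems.SolenoidalFractalHomogenisation.PermissibleCarrier
open Summit.AnomalousDissipation.AnomalousDissipation.Theorems.SolenoidalFractalHomogenisation.RealisedQuasiStaticCellLaw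

/-- `rate_budget` with the heat term written as `L·(1+η)·Q`, `L·Q = Δ₀` (the shape delivered by `galerkin_floor_cell`). -/
theorem rate_budget_LQ {η d Δ₀ Δ₁ δ L Q : ℝ} (hL : L * Q = Δ₀) (hη0 : 0 ≤ η) (hη : η ≤ δ / 8 * Δ₁) (hd0 : 0 ≤ d)
    (hd : d ≤ (1 + δ / 2) * Δ₁) (hΔ₀0 : 0 ≤ Δ₀) (hΔ₀ : Δ₀ ≤ 1) (hΔ₁ : 0 ≤ Δ₁)
    (hM : 16 * (2 * Δ₀ + 3 * Δ₁) ^ 2 ≤ δ * Δ₁) (hM1 : 2 * (2 * Δ₀ + 3 * Δ₁) ≤ 1) (hδ0 : 0 < δ) (hδ1 : δ ≤ 1) :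
    0 ≤ η + L * (1 + η) * Q + d ∧ η + L * (1 + η) * Q + d ≤ 1 / 2 ∧
      (η + L * (1 + η) * Q + d) * (1 + 2 * (η + L * (1 + η) * Q + d)) ≤ Δ₀ + (1 + δ) * Δ₁ := by
  have e : L * (1 + η) * Q = Δ₀ * (1 + η) := by rw [← hL]; ring
  rw [e]
  exact rate_budget hη0 hη hd0 hd hΔ₀0 hΔ₀ hΔ₁ hM hM1 hδ0 hδ1

/-- From the Galerkin floor `x₀(1−a)e^{−(a(1+2a)/Q)t}` (`x₀ = 1/2`, `0 ≤ a ≤ 1/2`, `a(1+2a) ≤ S ≤ Q·r`) to the target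
`(1/4)·e^{−rt}·E` with `E ≤ 1`. -/
theorem floor_compare {x0 a Q S r E t : ℝ} (hx0 : x0 = 1 / 2) (ha : a ≤ 1 / 2)
    (hS : a * (1 + 2 * a) ≤ S) (hSQ : S ≤ Q * r) (hQ : 0 < Q) (hE : E ≤ 1) (ht : 0 ≤ t) :
    1 / 4 * Real.exp (-r * t) * E ≤ x0 * (1 - a) * Real.exp (-(a * (1 + 2 * a) / Q) * t) := by
  have h1 : a * (1 + 2 * a) / Q ≤ r := by
    rw [div_le_iff₀ hQ]
    linarith [mul_comm Q r]
  have h2 : Real.exp (-r * t) ≤ Real.exp (-(a * (1 + 2 * a) / Q) * t) :=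
    Real.exp_le_exp.2 (by nlinarith [mul_le_mul_of_nonneg_right h1 ht])
  have h3 : 1 / 4 ≤ x0 * (1 - a) := by rw [hx0]; nlinarith
  have h4 : 0 ≤ 1 / 4 * Real.exp (-r * t) := by positivity
  calc 1 / 4 * Real.exp (-r * t) * E ≤ 1 / 4 * Real.exp (-r * t) * 1 := mul_le_mul_of_nonneg_left hE h4
    _ = 1 / 4 * Real.exp (-r * t) := mul_one _
    _ ≤ x0 * (1 - a) * Real.exp (-(a * (1 + 2 * a) / Q) * t) :=
        mul_le_mul h3 h2 (Real.exp_pos _).le (by rw [hx0]; nlinarith)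

/-- `floor_compare` fed directly by the rate-budget hypotheses (shape of `galerkin_floor_cell`'s `a`). -/
theorem floor_compare_LQ {x0 η L Q d Δ₀ Δ₁ δ r E t : ℝ} (hx0 : x0 = 1 / 2) (hL : L * Q = Δ₀) (hη0 : 0 ≤ η)
    (hη : η ≤ δ / 8 * Δ₁) (hd0 : 0 ≤ d) (hd : d ≤ (1 + δ / 2) * Δ₁) (hΔ₀0 : 0 ≤ Δ₀) (hΔ₀ : Δ₀ ≤ 1) (hΔ₁ : 0 ≤ Δ₁)
    (hM : 16 * (2 * Δ₀ + 3 * Δ₁) ^ 2 ≤ δ * Δ₁) (hM1 : 2 * (2 * Δ₀ + 3 * Δ₁) ≤ 1) (hδ0 : 0 < δ) (hδ1 : δ ≤ 1)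
    (hSQ : Δ₀ + (1 + δ) * Δ₁ ≤ Q * r) (hQ : 0 < Q) (hE : E ≤ 1) (ht : 0 ≤ t) :
    1 / 4 * Real.exp (-r * t) * E ≤
      x0 * (1 - (η + L * (1 + η) * Q + d)) *
        Real.exp (-((η + L * (1 + η) * Q + d) * (1 + 2 * (η + L * (1 + η) * Q + d)) / Q) * t) := by
  obtain ⟨-, ha, hprod⟩ := rate_budget_LQ hL hη0 hη hd0 hd hΔ₀0 hΔ₀ hΔ₁ hM hM1 hδ0 hδ1
  exact floor_compare hx0 ha hprod hSQ hQ hE ht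

/-- A frequency whose lattice vector has norm `≤ N` lies in the frequency ball of radius `N`. -/
theorem mem_freqBall_of_norm_le {N : ℕ} {k : Fin 3 → ℤ} (h : ‖latticeVec k‖ ≤ N) : k ∈ freqBall N := by
  rw [mem_freqBall, ← norm_latticeVec_sq]
  exact pow_le_pow_left₀ (norm_nonneg _) h 2

/-- `latticeVec` of a negated frequency. -/
theorem latticeVec_neg_fin3 (k : Fin 3 → ℤ) : latticeVec (-k) = -latticeVec k := by
  ext i
  simp [latticeVec_apply]

/-- `latticeVec` of a difference of frequencies. -/
theorem latticeVec_sub_fin3 (k l : Fin 3 → ℤ) : latticeVec (k - l) = latticeVec k - latticeVec l := by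
  ext i
  simp [latticeVec_apply]

/-- `latticeVec` of a sum of frequencies. -/
theorem latticeVec_add_fin3 (k l : Fin 3 → ℤ) : latticeVec (k + l) = latticeVec k + latticeVec l := by
  ext i
  simp [latticeVec_apply]

/-- The modulus of the conjugate layer amplitude: `|a'_j| = 1/(2·2π|m_j|)`. -/
theorem norm_layerAmp_conj (P : LatticePhase) :
    ‖starRingEnd ℂ (Complex.exp (P.φ * Complex.I)) *
        (-(1 / (2 * ((2 * Real.pi * ‖latticeVec P.m‖ : ℝ) : ℂ) * Complex.I)))‖ =
      1 / (2 * (2 * Real.pi * ‖latticeVec P.m‖)) := by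
  rw [norm_mul, norm_neg, Complex.norm_conj, ← norm_mul]
  exact norm_layerAmp P

/-- Isotropy with the SAME nominal constant is preserved by stretching the slots (both `Σ slotGain` and the period
scale by `s`). -/
private theorem isotropicWordGain_stretch_same {k : ℕ} {W : LatticeWord k} {c₀ : ℝ} (h : IsotropicWordGain W c₀)
    (s : ℝ) (hs : 0 < s) : IsotropicWordGain (W.stretch s hs) c₀ := by
  intro q p hq hp hpq
  have hslot : ∀ j, slotGain ((W.stretch s hs).phase j) q p = s * slotGain (W.phase j) q p := fun j => by
    simp only [slotGain, LatticeWord.stretch]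
    ring
  simp only [hslot, ← Finset.mul_sum, h q p hq hp hpq, period_stretch]
  ring

set_option maxHeartbeats 1600000 in
/-- **The general-word realised energy floor** (hypothesis `hfloor` of `not_quasiStatic_of_floorAll`, verbatim).
See the module docstring. -/
theorem floorAll : ∀ k (W : LatticeWord k) (c₀ : ℝ), 0 < c₀ → IsotropicWordGain W c₀ → ∀ δ > (0:ℝ), ∀ ν, ∀ hν : 0 < ν,
      ∃ n₀ : ℕ, ∃ C > (0:ℝ), ∀ n : ℕ, n₀ ≤ n → ∀ T > (0:ℝ),
        ∃ w, Torus.IsWeakPassiveVectorOn 0 T (ν / (n:ℝ) ^ 2) ((W.stretch (1 / ν) (one_div_pos.mpr hν)).cell n)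
            (fun x => (UnitAddTorus.mFourier (Pi.single 0 1 : Fin 3 → ℤ) x).re •
              (EuclideanSpace.single 1 (1:ℝ) : EuclideanSpace ℝ (Fin 3))) w ∧
          ∀ᵐ t ∂(volume.restrict (Ioo 0 T)),
            C * Real.exp (-(8 * Real.pi ^ 2 * (1 + (1 + δ) * ((1 - 4 * W.ramp / 3) * c₀) / ν ^ 2) * ν / (n:ℝ) ^ 2) * t) *
                ∫ x, ‖(UnitAddTorus.mFourier (Pi.single 0 1 : Fin 3 → ℤ) x).re •
                  (EuclideanSpace.single 1 (1:ℝ) : EuclideanSpace ℝ (Fin 3))‖ ^ 2 ≤ ∫ x, ‖w t x‖ ^ 2 := by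
  intro k W c₀ hc₀ hW δ hδ ν hν
  classical
  -- constants of the word
  have hπ := Real.pi_gt_three
  have hπ0 := Real.pi_pos
  have hP : 0 < W.period := period_pos W
  have hρ0 : 0 < W.ramp := W.ramp_pos
  have hρ2 : W.ramp ≤ 1 / 2 := W.ramp_le
  have hρ3 : 0 < 1 - 4 * W.ramp / 3 := by linarith
  have hcW0 : 0 < (1 - 4 * W.ramp / 3) * c₀ := mul_pos hρ3 hc₀
  -- the shortest slot
  obtain ⟨j₀, -, hj₀⟩ := Finset.exists_min_image Finset.univ (fun j : Fin k => (W.phase j).τ)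
    ⟨⟨0, W.pos⟩, Finset.mem_univ _⟩
  set τm : ℝ := (W.phase j₀).τ with hτmdef
  have hτm0 : 0 < τm := (W.phase j₀).τ_pos
  have hτm : ∀ j, τm ≤ (W.phase j).τ := fun j => hj₀ j (Finset.mem_univ j)
  -- the precision `δ' = min δ 1`
  set δ' : ℝ := min δ 1 with hδ'
  have hδ'0 : 0 < δ' := lt_min hδ one_pos
  have hδ'1 : δ' ≤ 1 := min_le_right _ _
  have hδ'δ : δ' ≤ δ := min_le_left _ _
  -- the window count `q`
  set q : ℕ := ⌈32 / (Real.pi ^ 2 * (1 - 4 * W.ramp / 3) * τm * δ')⌉₊ + ⌈1 / W.period⌉₊ + 1 with hqdef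
  have hq0 : 0 < q := by rw [hqdef]; positivity
  have hq0r : (0:ℝ) < q := by exact_mod_cast hq0
  have hqr : (q:ℝ) = (⌈32 / (Real.pi ^ 2 * (1 - 4 * W.ramp / 3) * τm * δ')⌉₊ : ℕ) + (⌈1 / W.period⌉₊ : ℕ) + 1 := by
    rw [hqdef]; push_cast; ring
  have hq32 : 32 / (Real.pi ^ 2 * (1 - 4 * W.ramp / 3) * τm * δ') ≤ q := by
    rw [hqr]
    have h1 := Nat.le_ceil (32 / (Real.pi ^ 2 * (1 - 4 * W.ramp / 3) * τm * δ'))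
    have h2 : (0:ℝ) ≤ (⌈1 / W.period⌉₊ : ℕ) := Nat.cast_nonneg _
    linarith
  have hqP : 1 ≤ (q:ℝ) * W.period := by
    rw [hqr]
    have h1 := Nat.le_ceil (1 / W.period)
    have h2 : (0:ℝ) ≤ (⌈32 / (Real.pi ^ 2 * (1 - 4 * W.ramp / 3) * τm * δ')⌉₊ : ℕ) := Nat.cast_nonneg _
    have h3 : 1 / W.period * W.period = 1 := by field_simp
    nlinarith
  -- the heat (`A/n²`) and realised Taylor (`B/n²`) parts of one window
  obtain ⟨A, hAdef⟩ : ∃ A : ℝ, A = 8 * Real.pi ^ 2 * q * W.period := ⟨_, rfl⟩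
  obtain ⟨B, hBdef⟩ : ∃ B : ℝ, B = A * ((1 - 4 * W.ramp / 3) * c₀) / ν ^ 2 := ⟨_, rfl⟩
  have hA0 : 0 < A := by rw [hAdef]; positivity
  have hB0 : 0 < B := by rw [hBdef]; positivity
  -- the cell threshold
  obtain ⟨X, hXdef⟩ : ∃ X : ℝ, X = 3 + 16 / δ' + 3 / (Real.pi ^ 4 * c₀ * δ') +
      162 * (k:ℝ) ^ 2 * (q:ℝ) ^ 2 * W.period ^ 2 / (Real.pi ^ 4 * c₀ * δ' ^ 2 * ν ^ 2) + A +
      16 * (2 * A + 3 * B) ^ 2 / (δ' * B) + 2 * (2 * A + 3 * B) +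
      4 * B / (Real.pi ^ 2 * q * (1 - 4 * W.ramp / 3) * τm) := ⟨_, rfl⟩
  refine ⟨⌈X⌉₊, 1 / 4, by norm_num, fun n hn T hT => ?_⟩
  -- unpack the threshold
  have hnX : X ≤ n := le_trans (Nat.le_ceil X) (by exact_mod_cast hn)
  rw [hXdef] at hnX
  have t1 : (0:ℝ) ≤ 16 / δ' := by positivity
  have t2 : (0:ℝ) ≤ 3 / (Real.pi ^ 4 * c₀ * δ') := by positivity
  have t3 : (0:ℝ) ≤ 162 * (k:ℝ) ^ 2 * (q:ℝ) ^ 2 * W.period ^ 2 / (Real.pi ^ 4 * c₀ * δ' ^ 2 * ν ^ 2) := by positivity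
  have t5 : (0:ℝ) ≤ 16 * (2 * A + 3 * B) ^ 2 / (δ' * B) := by positivity
  have t7 : (0:ℝ) ≤ 4 * B / (Real.pi ^ 2 * q * (1 - 4 * W.ramp / 3) * τm) := by positivity
  have hn3 : (3:ℝ) ≤ n := by linarith
  have hn' : (0:ℝ) < n := by linarith
  have hnn : 0 < n := by exact_mod_cast hn'
  have hnsq : (n:ℝ) ≤ (n:ℝ) ^ 2 := by nlinarith
  have hn2pos : (0:ℝ) < (n:ℝ) ^ 2 := by positivity
  have hT2 : 16 / δ' ≤ n := by linarith
  have hT3 : 3 ≤ Real.pi ^ 4 * c₀ * δ' * n := by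
    have h : 3 / (Real.pi ^ 4 * c₀ * δ') ≤ n := by linarith
    rw [div_le_iff₀ (by positivity)] at h
    linarith
  have hT4 : 162 * (k:ℝ) ^ 2 * (q:ℝ) ^ 2 * W.period ^ 2 ≤ Real.pi ^ 4 * c₀ * δ' ^ 2 * ν ^ 2 * (n:ℝ) ^ 2 := by
    have h : 162 * (k:ℝ) ^ 2 * (q:ℝ) ^ 2 * W.period ^ 2 / (Real.pi ^ 4 * c₀ * δ' ^ 2 * ν ^ 2) ≤ (n:ℝ) ^ 2 := by linarith
    rw [div_le_iff₀ (by positivity)] at h; linarith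
  have hT5 : 8 * Real.pi ^ 2 * q * W.period ≤ (n:ℝ) ^ 2 := by rw [← hAdef]; linarith
  have hT6 : 16 * (2 * A + 3 * B) ^ 2 ≤ δ' * B * (n:ℝ) ^ 2 := by
    have h : 16 * (2 * A + 3 * B) ^ 2 / (δ' * B) ≤ (n:ℝ) ^ 2 := by linarith
    rw [div_le_iff₀ (by positivity)] at h; linarith
  have hT7 : 2 * (2 * A + 3 * B) ≤ (n:ℝ) ^ 2 := by linarith
  have hT8 : 4 * B ≤ Real.pi ^ 2 * q * (1 - 4 * W.ramp / 3) * τm * (n:ℝ) ^ 2 := by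
    have h : 4 * B / (Real.pi ^ 2 * q * (1 - 4 * W.ramp / 3) * τm) ≤ (n:ℝ) ^ 2 := by linarith
    rw [div_le_iff₀ (by positivity)] at h; linarith
  -- `Δ₀ = A/n²`, `Δ₁ = B/n²`, the cone `η`
  set Δ₀ : ℝ := 8 * Real.pi ^ 2 * q * W.period / (n:ℝ) ^ 2 with hΔ₀
  set Δ₁ : ℝ := 8 * Real.pi ^ 2 * q * W.period / (n:ℝ) ^ 2 * ((1 - 4 * W.ramp / 3) * c₀) / ν ^ 2 with hΔ₁
  have hΔ₀A : Δ₀ = A / (n:ℝ) ^ 2 := by rw [hΔ₀, hAdef]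
  have hΔ₁B : Δ₁ = B / (n:ℝ) ^ 2 := by rw [hΔ₁, hBdef, hAdef]; field_simp
  have hΔ₀0 : 0 ≤ Δ₀ := by rw [hΔ₀A]; positivity
  have hΔ₁0 : 0 ≤ Δ₁ := by rw [hΔ₁B]; positivity
  have hΔ₀1 : Δ₀ ≤ 1 := by rw [hΔ₀A, div_le_one hn2pos, hAdef]; exact hT5
  have hM : 16 * (2 * Δ₀ + 3 * Δ₁) ^ 2 ≤ δ' * Δ₁ := by
    rw [hΔ₀A, hΔ₁B]
    have e1 : 16 * (2 * (A / (n:ℝ) ^ 2) + 3 * (B / (n:ℝ) ^ 2)) ^ 2 =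
        16 * (2 * A + 3 * B) ^ 2 / ((n:ℝ) ^ 2 * (n:ℝ) ^ 2) := by field_simp
    have e2 : δ' * (B / (n:ℝ) ^ 2) = δ' * B * (n:ℝ) ^ 2 / ((n:ℝ) ^ 2 * (n:ℝ) ^ 2) := by field_simp
    rw [e1, e2]
    exact div_le_div_of_nonneg_right hT6 (by positivity)
  have hM1 : 2 * (2 * Δ₀ + 3 * Δ₁) ≤ 1 := by
    rw [hΔ₀A, hΔ₁B]
    have e1 : 2 * (2 * (A / (n:ℝ) ^ 2) + 3 * (B / (n:ℝ) ^ 2)) = 2 * (2 * A + 3 * B) / (n:ℝ) ^ 2 := by field_simp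
    rw [e1, div_le_one hn2pos]
    exact hT7
  set η : ℝ := 4 * Δ₁ / (Real.pi ^ 2 * q * (1 - 4 * W.ramp / 3) * τm) with hηdef
  have hη0 : 0 ≤ η := by rw [hηdef]; positivity
  have hη1 : η ≤ 1 := by
    rw [hηdef, div_le_one (by positivity), hΔ₁B]
    rw [show 4 * (B / (n:ℝ) ^ 2) = 4 * B / (n:ℝ) ^ 2 by ring, div_le_iff₀ hn2pos]
    exact hT8
  -- the cell word, its viscosity, the sector `e₀` and the polarisation `e₁`
  have hκ : 0 < ν / (n:ℝ) ^ 2 := by positivity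
  set W' := W.stretch (1 / ν) (one_div_pos.mpr hν) with hW'def
  have hW' : IsotropicWordGain W' c₀ := isotropicWordGain_stretch_same hW (1 / ν) (one_div_pos.mpr hν)
  have hP' : W'.period = W.period / ν := by rw [hW'def, period_stretch, one_div_mul_eq_div]
  have hρ' : W'.ramp = W.ramp := rfl
  have hm' : ∀ j, (W'.phase j).m = (W.phase j).m := fun j => rfl
  have hτ' : ∀ j, (W'.phase j).τ = 1 / ν * (W.phase j).τ := fun j => rfl
  set ℓ : Fin 3 → ℤ := Pi.single 0 1 with hℓdef
  set p : EuclideanSpace ℝ (Fin 3) := EuclideanSpace.single 1 (1:ℝ) with hpdef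
  have hℓ : ℓ ≠ 0 := fun h => by simpa [hℓdef] using congrFun h 0
  have hℓv : latticeVec ℓ = EuclideanSpace.single 0 (1:ℝ) := by rw [hℓdef]; exact latticeVec_single 0
  have hℓn1 : ‖latticeVec ℓ‖ = 1 := by rw [hℓv]; simp
  have hℓf : freqNormSq ℓ = 1 := by rw [← norm_latticeVec_sq, hℓn1, one_pow]
  have hp1 : ‖p‖ = 1 := by rw [hpdef]; simp
  have hpl : ⟪p, latticeVec ℓ⟫_ℝ = 0 := by
    rw [hℓv, hpdef, EuclideanSpace.inner_single_left]
    simp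
  have hℓn : 2 * ‖latticeVec ℓ‖ < n := by rw [hℓn1]; linarith
  -- the Galerkin data of the cell problem from the single-mode datum
  set hPV := pvSetup_cell W' hnn hκ.le ℓ (memSobolev_one_singleMode ℓ p) (isWeaklyDivFree_singleMode ℓ hpl)
    (hasZeroMean_singleMode hℓ p) (mFourierCoeff_singleMode_eq_zero_of_not_sector ℓ p n) with hPVdef
  have hE1 : ∫ x, ‖(UnitAddTorus.mFourier ℓ x).re • p‖ ^ 2 ≤ 1 := by
    have h := integral_norm_sq_singleMode_le ℓ p
    rwa [hp1, one_pow] at h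
  -- a radius resolving the carrier modes
  set S : ℝ := ∑ j : Fin k, ‖latticeVec (W.phase j).m‖ with hSdef
  have hS0 : 0 ≤ S := Finset.sum_nonneg fun j _ => norm_nonneg _
  have hSj : ∀ j, ‖latticeVec (W.phase j).m‖ ≤ S := fun j =>
    Finset.single_le_sum (f := fun j => ‖latticeVec (W.phase j).m‖) (fun i _ => norm_nonneg _) (Finset.mem_univ j)
  -- slot data of the cell word
  have hτm' : ∀ j, τm / ν ≤ (W'.phase j).τ := fun j => by
    rw [hτ' j, one_div_mul_eq_div]
    exact div_le_div_of_nonneg_right (hτm j) hν.le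
  have hτmν : 0 < τm / ν := div_pos hτm0 hν
  have hε : (0:ℝ) < δ' / 8 := by positivity
  have hX1 : 0 < 1 - 1 / (n:ℝ) := by rw [sub_pos, div_lt_one hn']; linarith
  have hQ0 : 0 < (q:ℝ) * (W.period / ν) := by positivity
  -- the exchange constant `cF ≤ k/n`
  have hcF : ∑ j : Fin k, (1 / (n : ℝ)) * (2 * Real.pi * |∑ i, (W'.phase j).e i * (ℓ i : ℝ)|) *
      (‖Complex.exp ((W'.phase j).φ * Complex.I) * (1 / (2 * ((2 * Real.pi * ‖latticeVec (W'.phase j).m‖ : ℝ) : ℂ) * Complex.I))‖ +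
        ‖starRingEnd ℂ (Complex.exp ((W'.phase j).φ * Complex.I)) *
          (-(1 / (2 * ((2 * Real.pi * ‖latticeVec (W'.phase j).m‖ : ℝ) : ℂ) * Complex.I)))‖) ≤ (k:ℝ) / n := by
    have hterm : ∀ j : Fin k, (1 / (n : ℝ)) * (2 * Real.pi * |∑ i, (W'.phase j).e i * (ℓ i : ℝ)|) *
        (‖Complex.exp ((W'.phase j).φ * Complex.I) * (1 / (2 * ((2 * Real.pi * ‖latticeVec (W'.phase j).m‖ : ℝ) : ℂ) * Complex.I))‖ +
          ‖starRingEnd ℂ (Complex.exp ((W'.phase j).φ * Complex.I)) *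
            (-(1 / (2 * ((2 * Real.pi * ‖latticeVec (W'.phase j).m‖ : ℝ) : ℂ) * Complex.I)))‖) ≤ 1 / n := by
      intro j
      rw [norm_layerAmp (W'.phase j), norm_layerAmp_conj (W'.phase j)]
      have hm1 : 1 ≤ ‖latticeVec (W'.phase j).m‖ := one_le_norm_latticeVec (W'.phase j).m_ne
      have hc : |∑ i, (W'.phase j).e i * (ℓ i : ℝ)| ≤ 1 := by rw [← hℓn1]; exact coupling_abs_le _ ℓ
      have hc0 : 0 ≤ |∑ i, (W'.phase j).e i * (ℓ i : ℝ)| := abs_nonneg _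
      have e : 1 / (n:ℝ) * (2 * Real.pi * |∑ i, (W'.phase j).e i * (ℓ i : ℝ)|) *
          (1 / (2 * (2 * Real.pi * ‖latticeVec (W'.phase j).m‖)) + 1 / (2 * (2 * Real.pi * ‖latticeVec (W'.phase j).m‖))) =
          1 / (n:ℝ) * (|∑ i, (W'.phase j).e i * (ℓ i : ℝ)| / ‖latticeVec (W'.phase j).m‖) := by
        field_simp
        ring
      rw [e]
      refine mul_le_of_le_one_right (by positivity) ?_
      rw [div_le_one (by positivity)]
      linarith
    calc _ ≤ ∑ j : Fin k, 1 / (n:ℝ) := Finset.sum_le_sum fun j _ => hterm j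
      _ = (k:ℝ) / n := by rw [Finset.sum_const, Finset.card_univ, Fintype.card_fin, nsmul_eq_mul]; ring
  have hcF0 : 0 ≤ ∑ j : Fin k, (1 / (n : ℝ)) * (2 * Real.pi * |∑ i, (W'.phase j).e i * (ℓ i : ℝ)|) *
      (‖Complex.exp ((W'.phase j).φ * Complex.I) * (1 / (2 * ((2 * Real.pi * ‖latticeVec (W'.phase j).m‖ : ℝ) : ℂ) * Complex.I))‖ +
        ‖starRingEnd ℂ (Complex.exp ((W'.phase j).φ * Complex.I)) *
          (-(1 / (2 * ((2 * Real.pi * ‖latticeVec (W'.phase j).m‖ : ℝ) : ℂ) * Complex.I)))‖) :=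
    Finset.sum_nonneg fun j _ => by positivity
  -- the comparison of the rates
  have hSQ : Δ₀ + (1 + δ') * Δ₁ ≤ (q:ℝ) * (W.period / ν) *
      (8 * Real.pi ^ 2 * (1 + (1 + δ) * ((1 - 4 * W.ramp / 3) * c₀) / ν ^ 2) * ν / (n:ℝ) ^ 2) := by
    have e : (q:ℝ) * (W.period / ν) *
        (8 * Real.pi ^ 2 * (1 + (1 + δ) * ((1 - 4 * W.ramp / 3) * c₀) / ν ^ 2) * ν / (n:ℝ) ^ 2) =
        Δ₀ + (1 + δ) * Δ₁ := by
      rw [hΔ₀, hΔ₁]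
      field_simp
    rw [e]
    have h := mul_le_mul_of_nonneg_right hδ'δ hΔ₁0
    linarith only [h]
  have hρ34 : W.ramp ≤ 3 / 4 := by linarith only [hρ2]
  have hρ34' : W.ramp < 3 / 4 := by linarith only [hρ2]
  -- the Galerkin lower bound, eventually in the truncation order
  have hΨ : ∀ᶠ N in atTop, ∀ t, 0 ≤ t →
      1 / 4 * Real.exp (-(8 * Real.pi ^ 2 * (1 + (1 + δ) * ((1 - 4 * W.ramp / 3) * c₀) / ν ^ 2) * ν / (n:ℝ) ^ 2) * t) *
          ∫ x, ‖(UnitAddTorus.mFourier ℓ x).re • p‖ ^ 2 ≤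
        ‖hPV.galerkinCoeffAt N t ℓ‖ ^ 2 + ‖hPV.galerkinCoeffAt N t (-ℓ)‖ ^ 2 := by
    refine Filter.eventually_atTop.2 ⟨⌈1 + (n:ℝ) * S⌉₊, fun N hN t ht => ?_⟩
    have hNr : 1 + (n:ℝ) * S ≤ N := le_trans (Nat.le_ceil _) (by exact_mod_cast hN)
    -- the ball resolves `ℓ`, the carrier modes and their first side bands
    have hKle : ∀ j, ‖latticeVec (fun i => (W'.phase j).m i * (n : ℤ))‖ ≤ (n:ℝ) * S := fun j => by
      rw [(dot_cast_cellFreq ℓ _ n).2, hm' j]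
      exact mul_le_mul_of_nonneg_left (hSj j) hn'.le
    have hnS0 : 0 ≤ (n:ℝ) * S := mul_nonneg hn'.le hS0
    have hℓN : ℓ ∈ freqBall N := mem_freqBall_of_norm_le (by rw [hℓn1]; linarith only [hNr, hnS0])
    have hBN : (Finset.univ.biUnion fun j : Fin k =>
        ({(fun i => (W'.phase j).m i * n), -(fun i => (W'.phase j).m i * n)} : Finset (Fin 3 → ℤ))) ⊆ freqBall N := by
      intro κ hκ'
      simp only [Finset.mem_biUnion, Finset.mem_univ, true_and, Finset.mem_insert, Finset.mem_singleton] at hκ'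
      obtain ⟨j, hj⟩ := hκ'
      rcases hj with rfl | rfl
      · exact mem_freqBall_of_norm_le (by linarith only [hKle j, hNr])
      · exact mem_freqBall_of_norm_le (by rw [latticeVec_neg_fin3, norm_neg]; linarith only [hKle j, hNr])
    have hball : ∀ j : Fin k, ∀ κ ∈ ({ℓ, -ℓ} : Finset (Fin 3 → ℤ)),
        κ - (fun i => (W'.phase j).m i * (n : ℤ)) ∈ freqBall N ∧ κ + (fun i => (W'.phase j).m i * (n : ℤ)) ∈ freqBall N := by
      intro j κ hκ'
      have hκn : ‖latticeVec κ‖ = 1 := by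
        rw [Finset.mem_insert, Finset.mem_singleton] at hκ'
        rcases hκ' with rfl | rfl
        · exact hℓn1
        · rw [latticeVec_neg_fin3, norm_neg, hℓn1]
      refine ⟨mem_freqBall_of_norm_le ?_, mem_freqBall_of_norm_le ?_⟩
      · rw [latticeVec_sub_fin3]
        refine (norm_sub_le _ _).trans ?_
        rw [hκn]
        linarith only [hKle j, hNr]
      · rw [latticeVec_add_fin3]
        refine (norm_add_le _ _).trans ?_
        rw [hκn]
        linarith only [hKle j, hNr]
    -- datum facts: `x(0) = 1/2`, `R(0) = 0`
    have hx0v : ‖hPV.galerkinCoeffAt N 0 ℓ‖ ^ 2 + ‖hPV.galerkinCoeffAt N 0 (-ℓ)‖ ^ 2 = 1 / 2 := by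
      rw [hPV.isConjSymm_galerkinCoeffAt N 0 ℓ, EuclideanSpace.norm_conjVec,
        singleMode_galerkin_norm_sq_zero hℓ hPV hℓN, hp1]
      norm_num
    have hR0 : ∑ κ ∈ freqBall N \ {ℓ, -ℓ}, ‖hPV.galerkinCoeffAt N 0 κ‖ ^ 2 = 0 := by
      refine Finset.sum_eq_zero fun κ hκ' => ?_
      rw [Finset.mem_sdiff, Finset.mem_insert, Finset.mem_singleton, not_or] at hκ'
      rw [singleMode_galerkinCoeffAt_zero_of_ne hPV N hκ'.2.1 hκ'.2.2, norm_zero]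
      norm_num
    -- the drain constant and the cone parameters
    have hd := drain_const_le hP hρ34 hc₀ hν hδ'0 hδ'1 hq0r.le hcF0 hcF hη0 hη1 hT2 hT3 hT4 hT5
    have hcone := cone_params hρ34' hτm0 hν hδ'0 hδ'1 hn' hq0r hq32 hΔ₁0 hd hηdef
    have hηle : η ≤ δ' / 8 * Δ₁ := hcone.2.1
    -- the Galerkin floor of the principal pair
    have key := galerkin_floor_cell W' hW' hnn hκ ℓ hℓ hℓn (memSobolev_one_singleMode ℓ p)
      (isWeaklyDivFree_singleMode ℓ hpl) (hasZeroMean_singleMode hℓ p)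
      (mFourierCoeff_singleMode_eq_zero_of_not_sector ℓ p n) hBN hℓN hball q hq0 hε hη0 hτmν hτm'
    refine le_trans ?cmp (key ?g1 ?g2 ?g3 ?g4 ?g5 t ht)
    case g1 =>
      rw [hP']
      exact gap_param hν hn' hqP
    case g5 =>
      show 0 < ‖hPV.galerkinCoeffAt N 0 ℓ‖ ^ 2 + ‖hPV.galerkinCoeffAt N 0 (-ℓ)‖ ^ 2
      rw [hx0v]; norm_num
    case g4 =>
      show ∑ κ ∈ freqBall N \ {ℓ, -ℓ}, ‖hPV.galerkinCoeffAt N 0 κ‖ ^ 2 ≤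
        η * (‖hPV.galerkinCoeffAt N 0 ℓ‖ ^ 2 + ‖hPV.galerkinCoeffAt N 0 (-ℓ)‖ ^ 2)
      rw [hR0, hx0v]
      positivity
    case g2 =>
      simp only [hP', hℓf, hℓn1, hρ']
      exact hcone.2.2
    case g3 =>
      simp only [hP', hℓf, hℓn1, hρ']
      refine (rate_budget_LQ ?_ hη0 hηle ?_ hd hΔ₀0 hΔ₀1 hΔ₁0 hM hM1 hδ'0 hδ'1).2.1
      · rw [hΔ₀]; field_simp; norm_num
      · positivity
    case cmp =>
      simp only [hP', hℓf, hℓn1, hρ']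
      refine floor_compare_LQ hx0v ?_ hη0 hηle ?_ hd hΔ₀0 hΔ₀1 hΔ₁0 hM hM1 hδ'0 hδ'1 hSQ hQ0 hE1 ht
      · rw [hΔ₀]; field_simp; norm_num
      · positivity
  exact exists_weak_singleMode_of_galerkinLowerBound W' hnn hκ hℓ hpl hΨ hT

end Summit.AnomalousDissipation.AnomalousDissipation.Theorems.QuasiStaticSolenoidalCellTensorQ.Negative

end
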